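import Literature.Geometry.Lorentzian.Basic
import Literature.Geometry.Lorentzian.Genericity
import HarnessLib

/-!
# Route PhotonSphereChannels · crux `TameCensorship` (stmt-FinalStateConjecture-17431) · line `Sketch`, skeleton v7 ·
# stub `stub_isSmoothDataFamily_timeReverse`: time reversal `(h, k) ↦ (h, −k)` preserves smooth families of data

Helper file (`--supports stmt-FinalStateConjecture-17431`) of line `Sketch` (lead c3, 2026-08-17). Skeleton v7 halves
the robust form of clause (i) of K3 by transporting probes along the data involution `(h, k) ↦ (h, −k)`; probes are
compactly supported jointly smooth `m`-parameter families `G : ℝᵐ → InitialDataSet (𝓡 3) X`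
(`InitialDataSet.IsSmoothDataFamily`, `Literature/Geometry/Lorentzian/Genericity.lean`), and this stub records that
the pointwise time-reversed family is again jointly smooth: the `h`-section map `(c, x) ↦ h_c(x)` is unchanged and the
`k`-section map `(c, x) ↦ k_c(x)` — a `C^∞` map `ℝᵐ × X → Hom(TX, Hom(TX, ℝ))` lying over `Prod.snd` — is negated
fibrewise. Negating a `C^n` map into the total space of a vector bundle ALONG A MAP of the source into the base keeps
it `C^n` (`contMDiffAt_neg_section_comp`, the along-a-map form of Mathlib's `ContMDiffAt.neg_section`: in the
trivialisation at the base point the fibre coordinate is linear, `Trivialization.linear`, so negation passes through,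
and `ContMDiffAt.neg` in the model fibre). Folklore differential topology; nothing analytic is claimed.
Stub-worker of the line lead prover-line-stmt-FinalStateConjecture-17431-c3-0, 2026-08-17.
-/

set_option linter.dupNamespace false

open Literature.Geometry.Lorentzian
open scoped Manifold ContDiff Topology
open Bundle Filter Set Function

noncomputable section

namespace Summit.FinalStateConjecture.FinalStateConjecture.Theorems.PhotonSphereChannels.TameCensorshipUnwind

/-- **Negation of a `C^n` map into a vector bundle along a map into the base.** Let `V` be a vector bundle over `B`
with model fibre `F`, `f : M → B` any map and `s x ∈ V (f x)` a lift of `f` to the total space. If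
`x ↦ (f x, s x)` is `C^n` at `x₀` then so is `x ↦ (f x, −s x)`: by `Bundle.contMDiffAt_totalSpace` this is the
conjunction of smoothness of `f` and of the fibre coordinate in the trivialisation `e` at `f x₀`, and on
`f ⁻¹' e.baseSet` (a neighbourhood of `x₀`, `f` being continuous at `x₀`) the fibre coordinate is linear
(`Trivialization.linear`), so the coordinate of `−s` is minus that of `s` (`ContMDiffAt.neg`,
`ContMDiffAt.congr_of_eventuallyEq`). The case `f = id` is Mathlib's `ContMDiffAt.neg_section`. [folklore] -/
private theorem contMDiffAt_neg_section_comp {𝕜 : Type*} [NontriviallyNormedField 𝕜]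
    {EM : Type*} [NormedAddCommGroup EM] [NormedSpace 𝕜 EM] {HM : Type*} [TopologicalSpace HM]
    {IM : ModelWithCorners 𝕜 EM HM} {M : Type*} [TopologicalSpace M] [ChartedSpace HM M]
    {EB : Type*} [NormedAddCommGroup EB] [NormedSpace 𝕜 EB] {HB : Type*} [TopologicalSpace HB]
    {IB : ModelWithCorners 𝕜 EB HB} {B : Type*} [TopologicalSpace B] [ChartedSpace HB B]
    {F : Type*} [NormedAddCommGroup F] [NormedSpace 𝕜 F]
    {V : B → Type*} [TopologicalSpace (TotalSpace F V)] [∀ b, TopologicalSpace (V b)]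
    [∀ b, AddCommGroup (V b)] [∀ b, Module 𝕜 (V b)] [FiberBundle F V] [VectorBundle 𝕜 F V]
    {n : WithTop ℕ∞} {f : M → B} {s : ∀ x : M, V (f x)} {x₀ : M}
    (hs : ContMDiffAt IM (IB.prod 𝓘(𝕜, F)) n (fun x ↦ TotalSpace.mk' F (f x) (s x)) x₀) :
    ContMDiffAt IM (IB.prod 𝓘(𝕜, F)) n (fun x ↦ TotalSpace.mk' F (f x) (-s x)) x₀ := by
  rw [contMDiffAt_totalSpace] at hs ⊢
  obtain ⟨hf, hs⟩ := hs
  refine ⟨hf, ?_⟩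
  dsimp only at hf hs ⊢
  set e := trivializationAt F V (f x₀)
  have hmem : ∀ᶠ x in 𝓝 x₀, f x ∈ e.baseSet :=
    hf.continuousAt.preimage_mem_nhds
      (e.open_baseSet.mem_nhds (FiberBundle.mem_baseSet_trivializationAt' (f x₀)))
  refine hs.neg.congr_of_eventuallyEq ?_
  filter_upwards [hmem] with x hx
  exact (e.linear 𝕜 hx).map_neg (s x)

/-- **Stub `stub_isSmoothDataFamily_timeReverse` of line `Sketch` (skeleton v7) for the crux
`PhotonSphereChannels.TameCensorship` (stmt-FinalStateConjecture-17431): time reversal preserves smooth families of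
initial data.** If `F, F' : ℝᵐ → InitialDataSet (𝓡 3) X` satisfy `(F' c).h = (F c).h` and
`(F' c).k x v w = −(F c).k x v w` for all `c, x, v, w` — i.e. `F' c` is the time-reversed datum `((F c).h, −(F c).k)` —
and `F` is a jointly smooth `m`-parameter family (`InitialDataSet.IsSmoothDataFamily m F`: the section maps
`(c, x) ↦ h_c(x)` and `(c, x) ↦ k_c(x)` are `C^∞` maps `ℝᵐ × X → Hom(TX, Hom(TX, ℝ))`), then so is `F'`: its
`h`-section map is that of `F` (rewrite), and its `k`-section map is the fibrewise negation of that of `F`, a `C^∞`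
map into the bundle of bilinear forms lying over `Prod.snd : ℝᵐ × X → X` (`contMDiffAt_neg_section_comp`).
[folklore] -/
theorem stub_isSmoothDataFamily_timeReverse :
    ∀ (X : Type) [TopologicalSpace X] [ChartedSpace E3 X] [IsManifold (𝓡 3) ∞ X] (m : ℕ)
    (F F' : EuclideanSpace ℝ (Fin m) → InitialDataSet (𝓡 3) X),
    (∀ c, (F' c).h = (F c).h) →
    (∀ c (x : X) (v w : TangentSpace (𝓡 3) x), (F' c).k x v w = -(F c).k x v w) →
    InitialDataSet.IsSmoothDataFamily m F → InitialDataSet.IsSmoothDataFamily m F' := by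
  intro X _ _ _ m F F' hh hk hF
  have hk' : ∀ (c : EuclideanSpace ℝ (Fin m)) (x : X), (F' c).k x = -(F c).k x := fun c x ↦ by
    ext v w
    rw [hk c x v w, neg_apply, neg_apply]
  refine ⟨?_, fun p ↦ ?_⟩
  · simp only [hh]
    exact hF.1
  · simp only [hk']
    exact contMDiffAt_neg_section_comp (hF.2 p)

end Summit.FinalStateConjecture.FinalStateConjecture.Theorems.PhotonSphereChannels.TameCensorshipUnwind

end
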